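import Summits.HodgeConjecture.HodgeConjecture.Theorems.LinearSystemTorelliLocalTubeSpanRadical

/-!
# Route LinearSystemTorelli — crux `LocalTubeSpan`: the isolated singular point, unconditionally

Helper file (`--supports stmt-HodgeConjecture-2490`, line `Sketch`, cycle 4 wave 2, stub
`stub_distinguishedBasis`).  The crux ("local Schnell theorem", C. Schnell, *Primitive cohomology
and the tube mapping*, Math. Z. 268 (2010) §3, §7) is reduced by the line to CYCLIC DETECTION —
injectivity of Schnell's third map `evalCoinv A : H¹(G, V) → ∏_{g ∈ G} V/(g - 1)V` — for the local
fundamental group `G = G_{s₀}` of the discriminant complement acting on the vanishing cohomology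
`V` through Picard–Lefschetz transvections `x ↦ x - B(x, δ) δ` of the alternating intersection form
`B`.  The tree's "one complete orbit" theorems (`localTubeSpan_injective_evalCoinv_of_completeOrbit`,
`localTubeSpan_injective_evalCoinv_of_vanishingLattice`) are CONDITIONAL on the named fact
`Schnell2010_lemma11` (a finite-index transvection frame, from `Janssen1983_thm2_9`).  This file is
the isolated-singularity case of the local Schnell theorem WITHOUT the named facts
`Schnell2010_lemma11` / `Janssen1983_thm2_9`:

* `localTubeSpan_injective_evalCoinv_of_distinguishedBasis` — if `G` is generated by finitely many
  elements `t_i` (meridians) acting as transvections along LINEARLY INDEPENDENT cycles `δ_i`, no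
  `δ_i` being `B`-orthogonal to all the `δ_j` (connected Dynkin diagram; one singular point, not a
  node), then Schnell's third map is injective — whatever the ambient `V ⊇ L = ℚδ` and however
  degenerate the form on `L`.

Geometric reading: at an ISOLATED singular point of a member of the linear system the local
fundamental group of the discriminant complement is generated by `μ` meridians of a generic local
pencil whose vanishing cycles form a DISTINGUISHED BASIS of the Milnor lattice (Brieskorn,
Gabrielov), so the generating meridians are their own detecting frame: the vocabulary-free core
`localTubeSpan_injective_evalCoinv_of_frame_on_span` applies with `Δ = {δ_i}`, frame `u = t` and
exponent `m = 1`, and `δ_i ∉ rad L = L ∩ L^⊥` because some `B(δ_i, δ_j) ≠ 0`.  Schnell's Lemma 11 is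
needed only when the generating cycles are linearly DEPENDENT (the global pencil, non-isolated
singular members, extra nodes).

References: [Schnell2010] C. Schnell, Primitive cohomology and the tube mapping, Math. Z. 268
(2010) §7 Prop. 12.
-/

-- `Summit.HodgeConjecture.HodgeConjecture.Theorems` is the mandated namespace (single-conjunct summit:
-- Sub = Summit), which `linter.dupNamespace` flags on every declaration; the lakefile turns the
-- linter off tree-wide (weak option), restated here so stand-alone elaboration is warning-free too.
set_option linter.dupNamespace false

noncomputable section

open CategoryTheory groupCohomology
open Literature.AlgebraicGeometry.HodgeTheory

namespace Summit.HodgeConjecture.HodgeConjecture.Theorems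

section IsolatedPoint

/-- **The isolated singular point, unconditionally (distinguished basis of meridians).**  Let `G`
act on the finite-dimensional `ℚ`-space `V = A` and be generated by finitely many elements `t_i`
acting as transvections `x ↦ x - B(x, δ_i) δ_i` of an alternating form `B` along LINEARLY
INDEPENDENT cycles `δ_i`, none of which is `B`-orthogonal to all the others.  Then Schnell's third
map `H¹(G, V) → ∏_{g ∈ G} V/(g - 1)V` is injective (the ambient `V ⊇ L = ℚδ` arbitrary, the form on
`L` possibly degenerate).  Proof: the core frame theorem
`localTubeSpan_injective_evalCoinv_of_frame_on_span` with `Δ = {δ_i}`, the generators themselves as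
the frame and exponent `m = 1`; `δ_i ∉ L ∩ L^⊥` since some `B(δ_i, δ_j) ≠ 0`.  No named fact
(neither `Schnell2010_lemma11` nor `Janssen1983_thm2_9`) is used. [cite: Schnell2010, §7 Prop. 12] -/
theorem localTubeSpan_injective_evalCoinv_of_distinguishedBasis {G : Type} [Group G]
    (A : Rep.{0} ℚ G) [FiniteDimensional ℚ A.V]
    (B : LinearMap.BilinForm ℚ A.V) (hB : B.IsAlt) {r : ℕ} (t : Fin r → G)
    (ht : Subgroup.closure (Set.range t) = ⊤) (δ : Fin r → A.V) (hli : LinearIndependent ℚ δ)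
    (hPL : ∀ (i : Fin r) (x : A.V), A.ρ (t i) x = x - B x (δ i) • δ i)
    (hconn : ∀ i : Fin r, ∃ j : Fin r, B (δ i) (δ j) ≠ 0) :
    Function.Injective (evalCoinv A) := by
  refine localTubeSpan_injective_evalCoinv_of_frame_on_span A B hB (Set.range δ) (Set.range t) ht
    ?_ ?_ t δ hli hPL ?_
  · -- every generator `t i` is the transvection along `δ i ∈ Δ`
    rintro _ ⟨i, rfl⟩
    exact ⟨δ i, ⟨i, rfl⟩, hPL i⟩
  · -- no `δ i` lies in the radical `L ∩ L^⊥` of `L = ℚΔ`: some `B (δ i) (δ j) ≠ 0`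
    rintro _ ⟨i, rfl⟩ hmem
    obtain ⟨j, hj⟩ := hconn i
    have h1 : B (δ j) (δ i) = 0 :=
      (LinearMap.BilinForm.mem_orthogonal_iff.1 hmem.2) _ (Submodule.subset_span ⟨j, rfl⟩)
    exact hj (by rw [← hB.neg_eq, h1, neg_zero])
  · -- the generators are their own frame: `t i = (t i) ^ 1` lies in the frame group
    rintro _ ⟨i, rfl⟩
    exact ⟨1, Nat.one_pos, t i, Subgroup.subset_closure ⟨i, rfl⟩, fun x _ => by rw [pow_one]⟩

end IsolatedPoint

end Summit.HodgeConjecture.HodgeConjecture.Theorems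

end
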